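/- Fleet seat `ym-wcr-19608-p2` (g2), route `WeakCouplingRates`, crux `BulkDominatesColdBoxW` (stmt-QuantumFields-19609), line `dlr-chessboard` (v8):
preliminaries for the exponent bookkeeping of `stub_kernelMeanExpansion`. -/
import Summits.QuantumFields.YangMills.Theorems.WeakCouplingRatesColdBoxDatumSplit
import Summits.QuantumFields.YangMills.Theorems.WeakCouplingRatesBulkDominatesColdBoxWNearCentreEdges
import Summits.QuantumFields.YangMills.Theorems.WeakCouplingRatesEventuallyPow

/-!
# Crux `BulkDominatesColdBoxW`, stub `stub_kernelMeanExpansion`: preliminaries for the assembly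

* `abs_dirBackground_sdat_le_of_not_touching` — off the plaquettes touching the cold box the scaled background circulation is a pure datum
  circulation, hence `≤ 4√(2β)r` (with `abs_glue_zero_le`, `abs_sCirc_glue_zero_le`, `abs_sdat_le_of_pinned`);
* `near_centre_mem_plaquettesTouching` — plaquettes near the centre touch the box;
* `kernelMean_rpow_dictionary`, `kernelMean_radius` — the `rpow` identities in the variables `A = β^{4θ}`, `D = β^{3θ+θ/5}`, `√β` used by the
  bookkeeping (`β^{4θ−1/2} = A/√β`, `β^{8θ−1} = A²/β`, …, `r = 278400√2·D/√β`, `√(2β)r = 556800·D`);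
* `kernelMean_eventually` — the twelve numeric «eventually in β» facts of the bookkeeping (instances of `…EventuallyPow`), under one threshold.
No sorry; no new definition; standard axioms.  NOT a claim about the mass gap.
-/

set_option autoImplicit false

noncomputable section

open MeasureTheory Finset
open Literature.Probability.LatticeModels (Site)
open Literature.MathematicalPhysics.QuantumLattice
open Literature.MathematicalPhysics.QuantumFieldTheory
open Literature.MathematicalPhysics.QuantumFieldTheory.LatticeMaxwell
open Literature.MathematicalPhysics.QuantumFieldTheory.AxialGauge

namespace Summit.QuantumFields.YangMills.Theorems.WeakCouplingRates

/-! ## The background circulation off the touching plaquettes is a datum circulation -/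

section OffTouching

variable {H : ℕ}

/-- The datum part of the glued field is bounded by the datum on the pinned edges: `|glue θ 0 e| ≤ K`. -/
theorem abs_glue_zero_le (θ : Literature.MathematicalPhysics.QuantumLattice.ZdEdge 4 → ℝ) {K : ℝ} (hK : 0 ≤ K)
    (hθ : ∀ e ∈ boxEdgesAt dirCorner (2 * H + 3), e ∉ dirFreeEdges H → |θ e| ≤ K)
    (e : Literature.MathematicalPhysics.QuantumLattice.ZdEdge 4) :
    |glue (pin := fun e => e ∉ dirFreeEdges H) dirCorner (2 * H + 3) θ (0 : DirFree H → ℝ) e| ≤ K := by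
  by_cases he : e ∈ boxEdgesAt dirCorner (2 * H + 3)
  · by_cases hp : e ∉ dirFreeEdges H
    · rw [glue_apply_pin _ _ he hp]; exact hθ e he hp
    · have h := glue_apply_free (pin := fun e => e ∉ dirFreeEdges H) θ (0 : DirFree H → ℝ) ⟨⟨e, he⟩, hp⟩
      simp only at h
      rw [h, Pi.zero_apply, abs_zero]; exact hK
  · rw [glue_apply_of_not_mem _ _ he, abs_zero]; exact hK

/-- The datum part of a circulation: `|sCirc (glue θ 0) p| ≤ 4K`. -/
theorem abs_sCirc_glue_zero_le (θ : Literature.MathematicalPhysics.QuantumLattice.ZdEdge 4 → ℝ) {K : ℝ} (hK : 0 ≤ K)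
    (hθ : ∀ e ∈ boxEdgesAt dirCorner (2 * H + 3), e ∉ dirFreeEdges H → |θ e| ≤ K) (p : Plaq 4) :
    |sCirc (glue (pin := fun e => e ∉ dirFreeEdges H) dirCorner (2 * H + 3) θ (0 : DirFree H → ℝ)) p| ≤ 4 * K := by
  have h := abs_glue_zero_le (H := H) θ hK hθ
  unfold sCirc
  have h1 := h (p.1, p.2.1); have h2 := h (p.1 + Pi.single p.2.1 1, p.2.2)
  have h3 := h (p.1 + Pi.single p.2.2 1, p.2.1); have h4 := h (p.1, p.2.2)
  rw [abs_le] at h1 h2 h3 h4 ⊢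
  constructor <;> linarith [h1.1, h1.2, h2.1, h2.2, h3.1, h3.2, h4.1, h4.2]

/-- The scaled datum on the pinned edges of the enlarged box: `|ϑ'_c e| ≤ √(2β)·r` (off the cold box from `Σ_c ϑ_{c,e}² ≤ r²`; `0` on the forest). -/
theorem abs_sdat_le_of_pinned {β r : ℝ} (hr : 0 ≤ r) {ϑ : Fin 3 → (Literature.MathematicalPhysics.QuantumLattice.ZdEdge 4 → ℝ)}
    (hϑ : ∀ e, e ∉ boxEdges 4 (2 * H + 1) → ∑ c, ϑ c e ^ 2 ≤ r ^ 2)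
    (hforest : ∀ x : Site 4, (∀ k : Fin 4, 1 ≤ x k ∧ x k + 1 ≤ 2 * (H : ℤ)) → ∀ c, ϑ c (x, 0) = 0) (c : Fin 3)
    (e : Literature.MathematicalPhysics.QuantumLattice.ZdEdge 4) (_he : e ∈ boxEdgesAt dirCorner (2 * H + 3)) (hpin : e ∉ dirFreeEdges H) :
    |sdat β ϑ c e| ≤ Real.sqrt (2 * β) * r := by
  rw [sdat_apply, abs_mul, abs_of_nonneg (Real.sqrt_nonneg _)]
  refine mul_le_mul_of_nonneg_left ?_ (Real.sqrt_nonneg _)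
  by_cases hΛ : e ∈ boxEdges 4 (2 * H + 1)
  · have hf : e.2 = 0 ∧ ∀ k : Fin 4, 1 ≤ e.1 k ∧ e.1 k + 1 ≤ 2 * (H : ℤ) := by
      by_contra hnot
      exact hpin (mem_dirFreeEdges.2 ⟨hΛ, by simpa using hnot⟩)
    obtain ⟨x, j⟩ := e
    obtain ⟨hj, hx⟩ := hf
    simp only at hj hx
    subst hj
    rw [hforest x hx c, abs_zero]; exact hr
  · have h := hϑ e hΛ
    have h1 : ϑ c e ^ 2 ≤ ∑ c', ϑ c' e ^ 2 := Finset.single_le_sum (f := fun c' => ϑ c' e ^ 2) (fun _ _ => sq_nonneg _) (Finset.mem_univ c)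
    exact abs_le_of_sq_le_sq (by nlinarith) hr

/-- **Off the touching plaquettes the scaled background circulation is a pure datum circulation**, hence `≤ 4√(2β)r`. -/
theorem abs_dirBackground_sdat_le_of_not_touching {β r : ℝ} (hr : 0 ≤ r) {ϑ : Fin 3 → (Literature.MathematicalPhysics.QuantumLattice.ZdEdge 4 → ℝ)}
    (hϑ : ∀ e, e ∉ boxEdges 4 (2 * H + 1) → ∑ c, ϑ c e ^ 2 ≤ r ^ 2)
    (hforest : ∀ x : Site 4, (∀ k : Fin 4, 1 ≤ x k ∧ x k + 1 ≤ 2 * (H : ℤ)) → ∀ c, ϑ c (x, 0) = 0) (c : Fin 3)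
    {p : ZdPlaquette 4} (hp : p ∉ plaquettesTouching (boxEdges 4 (2 * H + 1))) :
    |sCirc (glue (pin := fun e => e ∉ dirFreeEdges H) dirCorner (2 * H + 3) (sdat β ϑ c)
        (mean (fun e => e ∉ dirFreeEdges H) dirCorner (2 * H + 3) (sdat β ϑ c))) (p.1, p.2.1.1, p.2.1.2)| ≤ 4 * (Real.sqrt (2 * β) * r) := by
  rw [sCirc_glue_dir_congr_of_not_touching (sdat β ϑ c) _ 0 hp]
  exact abs_sCirc_glue_zero_le (H := H) (sdat β ϑ c) (by positivity) (fun e he hpe => abs_sdat_le_of_pinned hr hϑ hforest c e he hpe) _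

end OffTouching

/-! ## Small numeric facts -/

/-- A plaquette near the centre of the cold box (sup distance `≤ H/8`) touches the box (its edge `(x,1)` lies in it). -/
theorem near_centre_mem_plaquettesTouching {H : ℕ} (hH : 1 ≤ H) {x : Site 4} (hx : ∀ m : Fin 4, 8 * |x m - (H : ℤ)| ≤ (H : ℤ)) :
    ((x, ⟨((1 : Fin 4), (2 : Fin 4)), by decide⟩) : ZdPlaquette 4) ∈ plaquettesTouching (boxEdges 4 (2 * H + 1)) := by
  obtain ⟨h1, -, -, -⟩ := near_centre_plaquette_edges_mem hH hx (show (1 : Fin 4) ≠ 2 by decide)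
  rw [mem_plaquettesTouching_iff]
  exact ⟨(x, 1), Finset.mem_inter.2 ⟨by simp [plaquetteEdges], h1⟩⟩


/-! ## The `rpow` dictionary -/

/-- The `rpow` identities of the bookkeeping, in the variables `A = β^{4θ}`, `D = β^{3θ+θ/5}` and `√β`. -/
theorem kernelMean_rpow_dictionary {β : ℝ} (hβ0 : 0 < β) (θ : ℝ) :
    β ^ (2 * (4 * θ)) = (β ^ (4 * θ)) ^ 2 ∧ β ^ (16 * θ) = (β ^ (4 * θ)) ^ 4 ∧
    β ^ (4 * θ - 1 / 2) = β ^ (4 * θ) / Real.sqrt β ∧ β ^ (8 * θ - 1) = (β ^ (4 * θ)) ^ 2 / β ∧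
    β ^ (12 * θ - 1 / 2) = (β ^ (4 * θ)) ^ 3 / Real.sqrt β ∧ β ^ (20 * θ - 1 / 2) = (β ^ (4 * θ)) ^ 5 / Real.sqrt β ∧
    β ^ (16 * θ - 1) = (β ^ (4 * θ)) ^ 4 / β ∧ β ^ (18 * θ) = (β ^ (4 * θ)) ^ 4 * β ^ (2 * θ) ∧
    β ^ (2 * (4 * θ) - 1) = (β ^ (4 * θ)) ^ 2 / β ∧ Real.sqrt (β ^ (2 * (4 * θ) - 1)) = β ^ (4 * θ) / Real.sqrt β ∧
    β ^ (6 * θ + 2 * (θ / 5) - 1) = (β ^ (3 * θ + θ / 5)) ^ 2 / β ∧ (β ^ (4 * θ)) ^ 2 = β ^ (7 * θ) * β ^ θ := by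
  have hsβ : Real.sqrt β = β ^ (1 / 2 : ℝ) := Real.sqrt_eq_rpow β
  have hA0 : 0 ≤ β ^ (4 * θ) := Real.rpow_nonneg hβ0.le _
  have hpow : ∀ u v : ℝ, β ^ (u + v) = β ^ u * β ^ v := fun u v => Real.rpow_add hβ0 u v
  have hA2 : β ^ (2 * (4 * θ)) = (β ^ (4 * θ)) ^ 2 := by
    rw [show 2 * (4 * θ) = 4 * θ + 4 * θ by ring, hpow]; ring
  have hA4 : β ^ (16 * θ) = (β ^ (4 * θ)) ^ 4 := by
    rw [show (16 : ℝ) * θ = (4 * θ + 4 * θ) + (4 * θ + 4 * θ) by ring, hpow, hpow]; ring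
  have hAhalf : β ^ (4 * θ - 1 / 2) = β ^ (4 * θ) / Real.sqrt β := by
    rw [show 4 * θ - 1 / 2 = 4 * θ + (-(1 / 2 : ℝ)) by ring, hpow, Real.rpow_neg hβ0.le, ← hsβ, div_eq_mul_inv]
  have h8θ : β ^ (8 * θ - 1) = (β ^ (4 * θ)) ^ 2 / β := by
    rw [show 8 * θ - 1 = (4 * θ + 4 * θ) + (-1 : ℝ) by ring, hpow, hpow, Real.rpow_neg hβ0.le, Real.rpow_one]; ring
  have h12θ : β ^ (12 * θ - 1 / 2) = (β ^ (4 * θ)) ^ 3 / Real.sqrt β := by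
    rw [show 12 * θ - 1 / 2 = (4 * θ + 4 * θ) + (4 * θ - 1 / 2) by ring, hpow, hpow, hAhalf]; ring
  have h20θ : β ^ (20 * θ - 1 / 2) = (β ^ (4 * θ)) ^ 5 / Real.sqrt β := by
    rw [show 20 * θ - 1 / 2 = ((4 * θ + 4 * θ) + (4 * θ + 4 * θ)) + (4 * θ - 1 / 2) by ring, hpow, hpow, hpow, hAhalf]; ring
  have h16θ : β ^ (16 * θ - 1) = (β ^ (4 * θ)) ^ 4 / β := by
    rw [show 16 * θ - 1 = 16 * θ + (-1 : ℝ) by ring, hpow, hA4, Real.rpow_neg hβ0.le, Real.rpow_one]; ring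
  have h18θ : β ^ (18 * θ) = (β ^ (4 * θ)) ^ 4 * β ^ (2 * θ) := by
    rw [show (18 : ℝ) * θ = 16 * θ + 2 * θ by ring, hpow, hA4]
  have hεeq : β ^ (2 * (4 * θ) - 1) = (β ^ (4 * θ)) ^ 2 / β := by rw [show 2 * (4 * θ) - 1 = 8 * θ - 1 by ring, h8θ]
  have hsqrtε : Real.sqrt (β ^ (2 * (4 * θ) - 1)) = β ^ (4 * θ) / Real.sqrt β := by
    rw [hεeq, Real.sqrt_div' _ hβ0.le, Real.sqrt_sq hA0]
  have hDsq : β ^ (6 * θ + 2 * (θ / 5) - 1) = (β ^ (3 * θ + θ / 5)) ^ 2 / β := by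
    rw [show 6 * θ + 2 * (θ / 5) - 1 = ((3 * θ + θ / 5) + (3 * θ + θ / 5)) + (-1 : ℝ) by ring, hpow, hpow, Real.rpow_neg hβ0.le,
      Real.rpow_one]; ring
  have h7 : (β ^ (4 * θ)) ^ 2 = β ^ (7 * θ) * β ^ θ := by
    rw [← hpow, show 7 * θ + θ = 4 * θ + 4 * θ by ring, hpow]; ring
  exact ⟨hA2, hA4, hAhalf, h8θ, h12θ, h20θ, h16θ, h18θ, hεeq, hsqrtε, hDsq, h7⟩

/-- The exterior radius `r = √(2·278400²·β^{6θ+2δ−1})` (`δ = θ/5`) in the variables of the dictionary. -/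
theorem kernelMean_radius {β : ℝ} (hβ0 : 0 < β) (hβ1 : 1 ≤ β) {θ : ℝ} (hθ : 0 < θ) :
    Real.sqrt (2 * 278400 ^ 2 * β ^ (6 * θ + 2 * (θ / 5) - 1)) = 278400 * Real.sqrt 2 * β ^ (3 * θ + θ / 5) / Real.sqrt β ∧
    Real.sqrt (2 * β) * Real.sqrt (2 * 278400 ^ 2 * β ^ (6 * θ + 2 * (θ / 5) - 1)) = 556800 * β ^ (3 * θ + θ / 5) ∧
    Real.sqrt (2 * 278400 ^ 2 * β ^ (6 * θ + 2 * (θ / 5) - 1)) ≤ 278400 * Real.sqrt 2 * β ^ (4 * θ) / Real.sqrt β ∧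
    Real.sqrt (2 * 278400 ^ 2 * β ^ (6 * θ + 2 * (θ / 5) - 1)) ^ 2 = 2 * 278400 ^ 2 * β ^ (6 * θ + 2 * (θ / 5) - 1) := by
  obtain ⟨-, -, -, -, -, -, -, -, -, -, hDsq, -⟩ := kernelMean_rpow_dictionary hβ0 θ
  have hD0 : 0 ≤ β ^ (3 * θ + θ / 5) := Real.rpow_nonneg hβ0.le _
  have hDA : β ^ (3 * θ + θ / 5) ≤ β ^ (4 * θ) := Real.rpow_le_rpow_of_exponent_le hβ1 (by linarith)
  have hsβ0 : 0 < Real.sqrt β := Real.sqrt_pos.2 hβ0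
  have hsqrt2β : Real.sqrt (2 * β) = Real.sqrt 2 * Real.sqrt β := Real.sqrt_mul (by norm_num) β
  have hreq : Real.sqrt (2 * 278400 ^ 2 * β ^ (6 * θ + 2 * (θ / 5) - 1)) = 278400 * Real.sqrt 2 * β ^ (3 * θ + θ / 5) / Real.sqrt β := by
    rw [hDsq, show 2 * (278400 : ℝ) ^ 2 * ((β ^ (3 * θ + θ / 5)) ^ 2 / β) = 2 * ((278400 * β ^ (3 * θ + θ / 5)) ^ 2 / β) by ring,
      Real.sqrt_mul' _ (by positivity), Real.sqrt_div' _ hβ0.le, Real.sqrt_sq (by positivity)]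
    ring
  refine ⟨hreq, ?_, ?_, Real.sq_sqrt (by positivity)⟩
  · have h2 : Real.sqrt 2 * Real.sqrt 2 = 2 := Real.mul_self_sqrt (by norm_num)
    calc Real.sqrt (2 * β) * Real.sqrt (2 * 278400 ^ 2 * β ^ (6 * θ + 2 * (θ / 5) - 1))
        = (278400 * β ^ (3 * θ + θ / 5)) * (Real.sqrt 2 * Real.sqrt 2) * (Real.sqrt β / Real.sqrt β) := by rw [hsqrt2β, hreq]; ring
      _ = 556800 * β ^ (3 * θ + θ / 5) := by rw [h2, div_self hsβ0.ne']; ring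
  · rw [hreq]; gcongr

/-- The twelve numeric «eventually in `β`» facts of the bookkeeping of `stub_kernelMeanExpansion`, under one threshold (`0 < θ ≤ 1/100`). -/
theorem kernelMean_eventually {θ : ℝ} (hθ : 0 < θ) (hθ₂ : θ ≤ 1 / 100) :
    ∃ b : ℝ, 1 ≤ b ∧ ∀ β : ℝ, b ≤ β →
      4 * 10 ^ 8 * (2 * (⌈β ^ θ⌉₊ : ℝ) + 3) ^ 2 * β ^ (4 * θ - 1 / 2) ≤ β ^ (0 : ℝ) ∧
      4 * 43440 * (10 ^ 8) ^ 3 * (2 * (⌈β ^ θ⌉₊ : ℝ) + 3) ^ 10 * β ^ (12 * θ - 1 / 2) ≤ β ^ (0 : ℝ) ∧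
      4 * 8 * (10 ^ 8) ^ 2 * (2 * (⌈β ^ θ⌉₊ : ℝ) + 3) ^ 8 * β ^ (8 * θ - 1) ≤ β ^ (0 : ℝ) ∧
      32 * 43440 * (10 ^ 8) ^ 3 * (2 * (⌈β ^ θ⌉₊ : ℝ) + 3) ^ 10 * β ^ (20 * θ - 1 / 2) ≤ β ^ (-θ) ∧
      32 * 8 * (10 ^ 8) ^ 2 * (2 * (⌈β ^ θ⌉₊ : ℝ) + 3) ^ 8 * β ^ (16 * θ - 1) ≤ β ^ (-θ) ∧
      4 * 362 * (10 ^ 8) ^ 3 * (2 * (⌈β ^ θ⌉₊ : ℝ) + 3) ^ 6 * β ^ (12 * θ - 1 / 2) ≤ β ^ (-θ) ∧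
      7 * 362 * (10 ^ 8) ^ 3 * (2 * (⌈β ^ θ⌉₊ : ℝ) + 3) ^ 6 * β ^ (4 * θ - 1 / 2) ≤ β ^ (0 : ℝ) ∧
      16 * β ^ (0 : ℝ) ≤ β ^ θ ∧
      32 * β ^ (1 : ℝ) * Real.exp (-(β ^ (4 * θ))) ≤ β ^ (-θ) ∧
      12096 * 49 * β ^ (18 * θ) * Real.exp (-(β ^ (7 * θ))) ≤ β ^ (-θ) ∧
      1440 * (2 * (⌈β ^ θ⌉₊ : ℝ) + 3) ^ 4 * Real.exp (-(β ^ (7 * θ))) ≤ β ^ (0 : ℝ) ∧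
      8908800 * β ^ (3 * θ + θ / 5) ≤ β ^ (4 * θ) := by
  have hε0 : (0 : ℝ) < 4 * θ := by positivity
  have h7θ : (0 : ℝ) < 7 * θ := by positivity
  obtain ⟨b₁, hb₁1, E1⟩ := exists_const_mul_boxSide_pow_mul_rpow_le (4 * (10 : ℝ) ^ 8) 2 (a := 4 * θ - 1 / 2) (b := 0) hθ
    (by push_cast; linarith)
  obtain ⟨b₂, -, E2⟩ := exists_const_mul_boxSide_pow_mul_rpow_le (4 * 43440 * ((10 : ℝ) ^ 8) ^ 3) 10 (a := 12 * θ - 1 / 2) (b := 0) hθ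
    (by push_cast; linarith)
  obtain ⟨b₃, -, E3⟩ := exists_const_mul_boxSide_pow_mul_rpow_le (4 * 8 * ((10 : ℝ) ^ 8) ^ 2) 8 (a := 8 * θ - 1) (b := 0) hθ
    (by push_cast; linarith)
  obtain ⟨b₄, -, E4⟩ := exists_const_mul_boxSide_pow_mul_rpow_le (32 * 43440 * ((10 : ℝ) ^ 8) ^ 3) 10 (a := 20 * θ - 1 / 2) (b := -θ) hθ
    (by push_cast; linarith)
  obtain ⟨b₅, -, E5⟩ := exists_const_mul_boxSide_pow_mul_rpow_le (32 * 8 * ((10 : ℝ) ^ 8) ^ 2) 8 (a := 16 * θ - 1) (b := -θ) hθ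
    (by push_cast; linarith)
  obtain ⟨b₆, -, E6⟩ := exists_const_mul_boxSide_pow_mul_rpow_le (4 * 362 * ((10 : ℝ) ^ 8) ^ 3) 6 (a := 12 * θ - 1 / 2) (b := -θ) hθ
    (by push_cast; linarith)
  obtain ⟨b₇, -, E7⟩ := exists_const_mul_boxSide_pow_mul_rpow_le (7 * 362 * ((10 : ℝ) ^ 8) ^ 3) 6 (a := 4 * θ - 1 / 2) (b := 0) hθ
    (by push_cast; linarith)
  obtain ⟨b₈, -, E8⟩ := exists_const_mul_rpow_le_rpow 16 (a := 0) (b := θ) hθ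
  obtain ⟨b₉, -, E9⟩ := exists_const_mul_rpow_mul_exp_neg_le 32 1 (-θ) hε0
  obtain ⟨b₁₀, -, E10⟩ := exists_const_mul_rpow_mul_exp_neg_le (12096 * 49) (18 * θ) (-θ) h7θ
  obtain ⟨b₁₁, -, E11⟩ := exists_const_mul_boxSide_pow_mul_exp_neg_le 1440 4 hθ.le h7θ 0
  obtain ⟨b₁₂, -, E12⟩ := exists_const_mul_rpow_le_rpow 8908800 (a := 3 * θ + θ / 5) (b := 4 * θ) (by linarith)
  refine ⟨max (max (max (max b₁ b₂) (max b₃ b₄)) (max (max b₅ b₆) (max b₇ b₈))) (max (max b₉ b₁₀) (max b₁₁ b₁₂)),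
    le_trans hb₁1 (le_trans (le_trans (le_trans (le_max_left _ _) (le_max_left _ _)) (le_max_left _ _)) (le_max_left _ _)),
    fun β hβ => ?_⟩
  simp only [max_le_iff] at hβ
  obtain ⟨⟨⟨⟨hc1, hc2⟩, hc3, hc4⟩, ⟨hc5, hc6⟩, hc7, hc8⟩, ⟨hc9, hc10⟩, hc11, hc12⟩ := hβ
  exact ⟨E1 β hc1, E2 β hc2, E3 β hc3, E4 β hc4, E5 β hc5, E6 β hc6, E7 β hc7, E8 β hc8, E9 β hc9, E10 β hc10, E11 β hc11, E12 β hc12⟩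

end Summit.QuantumFields.YangMills.Theorems.WeakCouplingRates

end
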